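import Mathlib.Analysis.InnerProductSpace.Calculus
import Mathlib.Analysis.SpecialFunctions.SmoothTransition
import Mathlib.Analysis.SpecialFunctions.Sqrt
import Mathlib.Analysis.Calculus.Deriv.Inv
import Mathlib.Analysis.Calculus.Deriv.MeanValue
import Mathlib.Geometry.Manifold.Instances.Sphere
import Literature.Topology.FourManifolds.ImmersionCriterion
import Literature.Topology.FourManifolds.ImmersionOrientation
import HarnessLib

/-!
# Pushing an embedded disc of the sphere into the ball: neat discs with radial rims

Topic `Literature/Topology/FourManifolds`; first brick (D3-a) of the constructive road to
`Literature.Topology.FourManifolds.Trisection.isConnectedSum_of_reducing_separating`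
(`ReducibleTrisectionSplitting.lean`, § Status (P1′)): the discs through the `1`-handles and the
pushed Alexander balls of the "tree of balls" are all instances of the construction of this file.
**Everything here is proved; two auxiliary definitions (`PushProfile`, `PushProfile.push`), no
named fact.**

Setting.  `E : V → F` is a smooth map between real inner product spaces taking values on the
unit sphere of `F` (`‖E x‖ = 1`), injective and with injective differential — e.g. the
embeddings `ℝ² → 𝕊²` of the two sides of a circle
(`SphereCircleSplitting.exists_two_discs_sphere`) or the embedding `ℝ³ → 𝕊³` of Alexander's
theorem (`SphereEmbedding.schoenflies_exists_ball_holds`), composed with the inclusion of the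
sphere (§5).  The closed unit disc `𝔻 = {‖x‖ ≤ 1} ⊆ V` is then mapped onto the region `E(𝔻)` of
the sphere, with rim the embedded sphere `E(∂𝔻)`.  We push this region into the open unit ball of
`F`, keeping the rim fixed and VERTICAL (radial), by

  `push P E x = μ(‖x‖) • E (ν(‖x‖)/‖x‖ • x)`

for a *push profile* `P = (ε, μ, ν)` (§1): `μ` is the height (`= ‖x‖` on the rim collar
`1 - ε ≤ ‖x‖`, constant `1 - 2ε` on the floor `‖x‖ ≤ 1 - 2ε`) and `ν` reparametrises the
direction (`ν(r) = 1` on the rim collar, so that there the image point only slides radially,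
`ν(r) = r` for `r ≤ 1 - 3ε`).  Results:

* §1 `PushProfile`, `PushProfile.std` — the profile conditions and the standard profile built
  from `Real.smoothTransition`;
* §2 `PushProfile.dirScale`, `PushProfile.dir` — the direction map `x ↦ ν(‖x‖)/‖x‖ • x` is
  smooth (it is the identity near `0`), with `‖dir x‖ = ν ‖x‖`, and its differential kills no
  vector where `ν' > 0`;
* §3 `PushProfile.push` — `‖push x‖ = μ ‖x‖` (`norm_push`), rim formula
  `push x = ‖x‖ • E(x/‖x‖)` for `1 - ε ≤ ‖x‖` (`push_of_le_norm`), `push x = E x` on the unit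
  sphere, floor formula `push x = (1 - 2ε) • E x` for `‖x‖ ≤ 1 - 3ε`, images of the sphere /
  closed ball / open ball, smoothness (`contDiff_push`), injectivity (`injective_push`) and
  injectivity of the differential (`injective_fderiv_push`: on the floor side `ν' > 0` controls
  the radial direction, on the rim side `μ' > 0` does, and `E` is orthogonal to its differential
  since `‖E‖ ≡ 1`);
* §4 `PushProfile.isSmoothEmbedding_push` — `push` is a proper injective immersion, hence a smooth
  (closed) embedding `V ↪ F` (`isImmersion_of_injective_mfderiv`, `ImmersionCriterion.lean`);
* §5 `PushProfile.isSmoothEmbedding_push_sphere` — the hypotheses on `E = (↑) ∘ e` for a smooth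
  embedding `e : V → 𝕊ᵐ ⊆ F` (`mfderiv_coe_sphere_injective`,
  `injective_mfderiv_of_isImmersionAt'`), and the packaged statement;
* §6 `PushProfile.disjoint_image_push_of_subset` / `_of_disjoint` — LAMINAR FAMILIES: a disc
  pushed with a finer profile under a region contained in the interior part `E(𝔻_{1-3ε})` of
  another region is disjoint from the coarser disc (it hangs strictly higher), and discs under
  disjoint regions are disjoint.

This is the classical "push the interior of a spanning disc into the ball" (Kosinski,
*Differential Manifolds* (1993), VI §5, collars; Hirsch, *Differential Topology* (1976), Ch. 4
§6), made explicit so that the rim is exactly radial — the corner-straightness needed when such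
discs are continued as products through a handle (§ Status (P1′) of
`ReducibleTrisectionSplitting.lean`).

## References
* A. A. Kosinski, *Differential Manifolds*, Academic Press (1993), VI §5 (collars and neat
  submanifolds). [Kosinski1993]
* M. W. Hirsch, *Differential Topology*, GTM 33 (1976), Ch. 4 §6. [HirschDT1976]
-/

noncomputable section

open scoped ContDiff Topology Manifold RealInnerProductSpace
open Set Function Metric Filter

namespace Literature.Topology.FourManifolds

/-! ### §1 Push profiles -/

/-- A **push profile**: a rim width `ε ∈ (0, 1/4]`, a height function `μ` and a direction
reparametrisation `ν`, smooth, with `μ ≡ 1 - 2ε` on `(-∞, 1 - 2ε]`, `μ r = r` on `[1 - ε, ∞)`,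
`μ` strictly increasing on `[1 - 2ε, ∞)` with positive derivative on `(1 - 2ε, ∞)`; `ν r = r` on
`(-∞, 1 - 3ε]`, `ν ≡ 1` on `[1 - ε, ∞)`, `ν` strictly increasing on `[0, 1 - ε]` with positive
derivative on `(-∞, 1 - ε)`, and `r ≤ ν r` on `[0, 1]`.  (The standard profile `PushProfile.std`
shows these conditions are consistent.) [folklore] -/
structure PushProfile where
  /-- rim width -/
  ε : ℝ
  /-- height profile -/
  μ : ℝ → ℝ
  /-- direction profile -/
  ν : ℝ → ℝ
  ε_pos : 0 < ε
  ε_le : 4 * ε ≤ 1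
  contDiff_μ : ContDiff ℝ ∞ μ
  contDiff_ν : ContDiff ℝ ∞ ν
  μ_of_le : ∀ r, r ≤ 1 - 2 * ε → μ r = 1 - 2 * ε
  μ_of_ge : ∀ r, 1 - ε ≤ r → μ r = r
  μ_strictMonoOn : StrictMonoOn μ (Ici (1 - 2 * ε))
  μ_deriv_pos : ∀ r, 1 - 2 * ε < r → 0 < deriv μ r
  ν_of_le : ∀ r, r ≤ 1 - 3 * ε → ν r = r
  ν_of_ge : ∀ r, 1 - ε ≤ r → ν r = 1
  ν_strictMonoOn : StrictMonoOn ν (Icc 0 (1 - ε))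
  ν_deriv_pos : ∀ r, r < 1 - ε → 0 < deriv ν r
  le_ν : ∀ r, 0 ≤ r → r ≤ 1 → r ≤ ν r

namespace PushProfile

variable (P : PushProfile)

/-! #### Elementary consequences -/

/-- `1 - 3ε > 0`. [folklore] -/
theorem one_sub_three_mul_pos : 0 < 1 - 3 * P.ε := by linarith [P.ε_pos, P.ε_le]

/-- `1 - 2ε ≤ μ r`. [folklore] -/
theorem le_μ (r : ℝ) : 1 - 2 * P.ε ≤ P.μ r := by
  rcases le_or_gt r (1 - 2 * P.ε) with h | h
  · rw [P.μ_of_le r h]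
  · rw [← P.μ_of_le (1 - 2 * P.ε) le_rfl]
    exact (P.μ_strictMonoOn (mem_Ici.2 le_rfl) (mem_Ici.2 h.le) h).le

/-- `μ r > 0`. [folklore] -/
theorem μ_pos (r : ℝ) : 0 < P.μ r := by linarith [P.le_μ r, P.ε_pos, P.ε_le]

/-- `μ 1 = 1`. [folklore] -/
theorem μ_one : P.μ 1 = 1 := P.μ_of_ge 1 (by linarith [P.ε_pos])

/-- `μ r ≤ 1` for `r ≤ 1`. [folklore] -/
theorem μ_le_one {r : ℝ} (hr : r ≤ 1) : P.μ r ≤ 1 := by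
  rcases le_or_gt r (1 - 2 * P.ε) with h | h
  · rw [P.μ_of_le r h]; linarith [P.ε_pos]
  · rw [← P.μ_one]
    exact P.μ_strictMonoOn.monotoneOn (mem_Ici.2 h.le) (mem_Ici.2 (by linarith [P.ε_pos])) hr

/-- `μ r < 1` for `r < 1`. [folklore] -/
theorem μ_lt_one {r : ℝ} (hr : r < 1) : P.μ r < 1 := by
  rcases le_or_gt r (1 - 2 * P.ε) with h | h
  · rw [P.μ_of_le r h]; linarith [P.ε_pos]
  · rw [← P.μ_one]
    exact P.μ_strictMonoOn (mem_Ici.2 h.le) (mem_Ici.2 (by linarith [P.ε_pos])) hr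

/-- `μ r = 1 ↔ r = 1` for `0 ≤ r`... in fact for all `r`: `μ r = r` beyond `1 - ε`. [folklore] -/
theorem μ_eq_one_iff (r : ℝ) : P.μ r = 1 ↔ r = 1 := by
  refine ⟨fun h => ?_, fun h => h ▸ P.μ_one⟩
  rcases lt_trichotomy r 1 with hr | hr | hr
  · exact absurd h (P.μ_lt_one hr).ne
  · exact hr
  · rw [P.μ_of_ge r (by linarith [P.ε_pos])] at h
    exact h

/-- `ν 0 = 0`. [folklore] -/
theorem ν_zero : P.ν 0 = 0 := P.ν_of_le 0 P.one_sub_three_mul_pos.le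

/-- `ν r < 1` for `0 ≤ r < 1 - ε`. [folklore] -/
theorem ν_lt_one {r : ℝ} (h0 : 0 ≤ r) (hr : r < 1 - P.ε) : P.ν r < 1 := by
  rw [← P.ν_of_ge (1 - P.ε) le_rfl]
  exact P.ν_strictMonoOn ⟨h0, hr.le⟩ ⟨by linarith [P.ε_pos, P.ε_le], le_rfl⟩ hr

/-- `ν r ≤ 1` for `0 ≤ r`. [folklore] -/
theorem ν_le_one {r : ℝ} (h0 : 0 ≤ r) : P.ν r ≤ 1 := by
  rcases lt_or_ge r (1 - P.ε) with h | h
  · exact (P.ν_lt_one h0 h).le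
  · exact (P.ν_of_ge r h).le

/-- `0 < ν r` for `0 < r`. [folklore] -/
theorem ν_pos {r : ℝ} (hr : 0 < r) : 0 < P.ν r := by
  rcases le_or_gt r 1 with h | h
  · exact hr.trans_le (P.le_ν r hr.le h)
  · rw [P.ν_of_ge r (by linarith [P.ε_pos])]; exact one_pos

/-- `0 ≤ ν r` for `0 ≤ r`. [folklore] -/
theorem ν_nonneg {r : ℝ} (hr : 0 ≤ r) : 0 ≤ P.ν r := by
  rcases hr.eq_or_lt with h | h
  · rw [← h, P.ν_zero]
  · exact (P.ν_pos h).le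

/-- `ν r = 1 ↔ 1 - ε ≤ r`, for `0 ≤ r`. [folklore] -/
theorem ν_eq_one_iff {r : ℝ} (h0 : 0 ≤ r) : P.ν r = 1 ↔ 1 - P.ε ≤ r := by
  refine ⟨fun h => ?_, P.ν_of_ge r⟩
  by_contra hlt
  exact (P.ν_lt_one h0 (lt_of_not_ge hlt)).ne h

/-- **The two profiles separate radii**: `μ r = μ s` and `ν r = ν s` force `r = s` (`r, s ≥ 0`):
`ν` is injective on `[0, 1 - ε]` and `< 1` exactly there, `μ` is injective on `[1 - 2ε, ∞)`.
This is what makes the pushed disc injective. [folklore] -/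
theorem eq_of_μ_eq_of_ν_eq {r s : ℝ} (hr : 0 ≤ r) (hs : 0 ≤ s) (hμ : P.μ r = P.μ s)
    (hν : P.ν r = P.ν s) : r = s := by
  by_contra hne
  wlog hlt : r < s generalizing r s
  · exact this hs hr hμ.symm hν.symm (Ne.symm hne) (lt_of_le_of_ne (le_of_not_gt hlt) (Ne.symm hne))
  rcases le_or_gt s (1 - P.ε) with hs1 | hs1
  · exact (P.ν_strictMonoOn ⟨hr, hlt.le.trans hs1⟩ ⟨hs, hs1⟩ hlt).ne hν
  · rcases lt_or_ge r (1 - P.ε) with hr1 | hr1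
    · have h1 : P.ν r < 1 := P.ν_lt_one hr hr1
      rw [hν, P.ν_of_ge s hs1.le] at h1
      exact lt_irrefl _ h1
    · have ha : 1 - 2 * P.ε ≤ r := by linarith [P.ε_pos]
      exact (P.μ_strictMonoOn (mem_Ici.2 ha) (mem_Ici.2 (ha.trans hlt.le)) hlt).ne hμ

/-! #### The standard profile, built from `Real.smoothTransition` -/

namespace Std

variable (ε : ℝ)

/-- Standard height profile `μ r = a + (r - a)·ST((r - a)/ε)`, `a = 1 - 2ε`,
`ST = Real.smoothTransition`. [folklore] -/
def μ (r : ℝ) : ℝ :=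
  (1 - 2 * ε) + (r - (1 - 2 * ε)) * Real.smoothTransition ((r - (1 - 2 * ε)) / ε)

/-- Standard direction profile `ν r = r + (1 - r)·ST((r - (1 - 3ε))/(2ε))`. [folklore] -/
def ν (r : ℝ) : ℝ :=
  r + (1 - r) * Real.smoothTransition ((r - (1 - 3 * ε)) / (2 * ε))

/-- `μ` is smooth. [folklore] -/
theorem contDiff_μ : ContDiff ℝ ∞ (μ ε) := by
  unfold μ
  exact contDiff_const.add ((contDiff_id.sub contDiff_const).mul
    (Real.smoothTransition.contDiff.comp ((contDiff_id.sub contDiff_const).div_const ε)))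

/-- `ν` is smooth. [folklore] -/
theorem contDiff_ν : ContDiff ℝ ∞ (ν ε) := by
  unfold ν
  exact contDiff_id.add ((contDiff_const.sub contDiff_id).mul
    (Real.smoothTransition.contDiff.comp ((contDiff_id.sub contDiff_const).div_const (2 * ε))))

variable {ε}

/-- `μ ≡ 1 - 2ε` on `(-∞, 1 - 2ε]`. [folklore] -/
theorem μ_of_le (hε : 0 < ε) {r : ℝ} (hr : r ≤ 1 - 2 * ε) : μ ε r = 1 - 2 * ε := by
  unfold μ
  rw [Real.smoothTransition.zero_of_nonpos (div_nonpos_of_nonpos_of_nonneg (by linarith) hε.le)]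
  ring

/-- `μ r = r` on `[1 - ε, ∞)`. [folklore] -/
theorem μ_of_ge (hε : 0 < ε) {r : ℝ} (hr : 1 - ε ≤ r) : μ ε r = r := by
  unfold μ
  rw [Real.smoothTransition.one_of_one_le ((one_le_div hε).2 (by linarith))]
  ring

/-- The derivative of `μ`. [folklore] -/
theorem hasDerivAt_μ (ε r : ℝ) :
    HasDerivAt (μ ε) (Real.smoothTransition ((r - (1 - 2 * ε)) / ε) + (r - (1 - 2 * ε)) *
      (deriv Real.smoothTransition ((r - (1 - 2 * ε)) / ε) * (1 / ε))) r := by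
  have h1 : HasDerivAt (fun r : ℝ => (r - (1 - 2 * ε)) / ε) (1 / ε) r :=
    ((hasDerivAt_id' r).sub_const _).div_const ε
  have hST : HasDerivAt Real.smoothTransition
      (deriv Real.smoothTransition ((r - (1 - 2 * ε)) / ε)) ((r - (1 - 2 * ε)) / ε) :=
    ((Real.smoothTransition.contDiff (n := 1)).differentiable one_ne_zero _).hasDerivAt
  have h2 := hST.comp r h1
  simp only [Function.comp_def] at h2
  have h3 := ((hasDerivAt_id' r).sub_const (1 - 2 * ε)).mul h2
  have h4 := h3.const_add (1 - 2 * ε)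
  unfold μ
  exact h4.congr_deriv (by ring)

/-- `μ' > 0` on `(1 - 2ε, ∞)`. [folklore] -/
theorem deriv_μ_pos (hε : 0 < ε) {r : ℝ} (hr : 1 - 2 * ε < r) : 0 < deriv (μ ε) r := by
  rw [(hasDerivAt_μ ε r).deriv]
  have hu : 0 < (r - (1 - 2 * ε)) / ε := div_pos (by linarith) hε
  have h1 : 0 < Real.smoothTransition ((r - (1 - 2 * ε)) / ε) :=
    Real.smoothTransition.pos_of_pos hu
  have h2 : 0 ≤ deriv Real.smoothTransition ((r - (1 - 2 * ε)) / ε) :=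
    Real.smoothTransition.monotone.deriv_nonneg
  have h3 : 0 ≤ (r - (1 - 2 * ε)) * (deriv Real.smoothTransition ((r - (1 - 2 * ε)) / ε) *
      (1 / ε)) := mul_nonneg (by linarith) (mul_nonneg h2 (by positivity))
  linarith

/-- `μ` is strictly increasing on `[1 - 2ε, ∞)`. [folklore] -/
theorem strictMonoOn_μ (hε : 0 < ε) : StrictMonoOn (μ ε) (Ici (1 - 2 * ε)) :=
  strictMonoOn_of_deriv_pos (convex_Ici _) (contDiff_μ ε).continuous.continuousOn
    fun r hr => deriv_μ_pos hε (by simpa [interior_Ici] using hr)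

/-- `ν r = r` on `(-∞, 1 - 3ε]`. [folklore] -/
theorem ν_of_le (hε : 0 < ε) {r : ℝ} (hr : r ≤ 1 - 3 * ε) : ν ε r = r := by
  unfold ν
  rw [Real.smoothTransition.zero_of_nonpos
    (div_nonpos_of_nonpos_of_nonneg (by linarith) (by linarith))]
  ring

/-- `ν ≡ 1` on `[1 - ε, ∞)`. [folklore] -/
theorem ν_of_ge (hε : 0 < ε) {r : ℝ} (hr : 1 - ε ≤ r) : ν ε r = 1 := by
  unfold ν
  rw [Real.smoothTransition.one_of_one_le ((one_le_div (by linarith)).2 (by linarith))]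
  ring

/-- The derivative of `ν`. [folklore] -/
theorem hasDerivAt_ν (ε r : ℝ) :
    HasDerivAt (ν ε) (1 + (-1 * Real.smoothTransition ((r - (1 - 3 * ε)) / (2 * ε)) +
      (1 - r) * (deriv Real.smoothTransition ((r - (1 - 3 * ε)) / (2 * ε)) * (1 / (2 * ε))))) r := by
  have h1 : HasDerivAt (fun r : ℝ => (r - (1 - 3 * ε)) / (2 * ε)) (1 / (2 * ε)) r :=
    ((hasDerivAt_id' r).sub_const _).div_const (2 * ε)
  have hST : HasDerivAt Real.smoothTransition
      (deriv Real.smoothTransition ((r - (1 - 3 * ε)) / (2 * ε))) ((r - (1 - 3 * ε)) / (2 * ε)) :=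
    ((Real.smoothTransition.contDiff (n := 1)).differentiable one_ne_zero _).hasDerivAt
  have h2 := hST.comp r h1
  simp only [Function.comp_def] at h2
  have h3 : HasDerivAt (fun r : ℝ => 1 - r) (-1) r := by
    simpa using (hasDerivAt_id' r).const_sub 1
  have h4 := (hasDerivAt_id' r).add (h3.mul h2)
  unfold ν
  exact h4.congr_deriv (by ring)

/-- `ν' > 0` on `(-∞, 1 - ε)`. [folklore] -/
theorem deriv_ν_pos (hε : 0 < ε) {r : ℝ} (hr : r < 1 - ε) : 0 < deriv (ν ε) r := by
  rw [(hasDerivAt_ν ε r).deriv]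
  have hu : (r - (1 - 3 * ε)) / (2 * ε) < 1 := (div_lt_one (by linarith)).2 (by linarith)
  have h1 : Real.smoothTransition ((r - (1 - 3 * ε)) / (2 * ε)) < 1 :=
    Real.smoothTransition.lt_one_of_lt_one hu
  have h2 : 0 ≤ deriv Real.smoothTransition ((r - (1 - 3 * ε)) / (2 * ε)) :=
    Real.smoothTransition.monotone.deriv_nonneg
  have hr1 : 0 < 1 - r := by linarith
  have h3 : 0 ≤ (1 - r) * (deriv Real.smoothTransition ((r - (1 - 3 * ε)) / (2 * ε)) *
      (1 / (2 * ε))) := mul_nonneg hr1.le (mul_nonneg h2 (by positivity))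
  linarith

/-- `ν` is strictly increasing on `[0, 1 - ε]`. [folklore] -/
theorem strictMonoOn_ν (hε : 0 < ε) : StrictMonoOn (ν ε) (Icc 0 (1 - ε)) :=
  strictMonoOn_of_deriv_pos (convex_Icc _ _) (contDiff_ν ε).continuous.continuousOn
    fun r hr => deriv_ν_pos hε (by rw [interior_Icc] at hr; exact hr.2)

/-- `r ≤ ν r` on `[0, 1]` (indeed on `(-∞, 1]`). [folklore] -/
theorem le_ν {r : ℝ} (hr : r ≤ 1) : r ≤ ν ε r := by
  unfold ν
  have : 0 ≤ (1 - r) * Real.smoothTransition ((r - (1 - 3 * ε)) / (2 * ε)) :=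
    mul_nonneg (by linarith) (Real.smoothTransition.nonneg _)
  linarith

end Std

/-- **The standard push profile** of rim width `ε ∈ (0, 1/4]`. [folklore] -/
def std (ε : ℝ) (hε : 0 < ε) (hε4 : 4 * ε ≤ 1) : PushProfile where
  ε := ε
  μ := Std.μ ε
  ν := Std.ν ε
  ε_pos := hε
  ε_le := hε4
  contDiff_μ := Std.contDiff_μ ε
  contDiff_ν := Std.contDiff_ν ε
  μ_of_le _ hr := Std.μ_of_le hε hr
  μ_of_ge _ hr := Std.μ_of_ge hε hr
  μ_strictMonoOn := Std.strictMonoOn_μ hε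
  μ_deriv_pos _ hr := Std.deriv_μ_pos hε hr
  ν_of_le _ hr := Std.ν_of_le hε hr
  ν_of_ge _ hr := Std.ν_of_ge hε hr
  ν_strictMonoOn := Std.strictMonoOn_ν hε
  ν_deriv_pos _ hr := Std.deriv_ν_pos hε hr
  le_ν _ _ hr := Std.le_ν hr

/-- The rim width of the standard profile is `ε`. [folklore] -/
@[simp] theorem std_ε (ε : ℝ) (hε : 0 < ε) (hε4 : 4 * ε ≤ 1) : (std ε hε hε4).ε = ε := rfl

/-! ### §2 The direction map `x ↦ ν(‖x‖)/‖x‖ • x` -/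

/-- The scalar factor of the direction map: `dirScale r = 1 + (ν r - r)/r`, i.e. `ν r / r` for
`r ≠ 0` and `1` wherever `ν r = r` (in particular near `r = 0`, which makes it smooth).
[folklore] -/
def dirScale (r : ℝ) : ℝ := 1 + (P.ν r - r) * r⁻¹

/-- `dirScale r · r = ν r`. [folklore] -/
theorem dirScale_mul (r : ℝ) : P.dirScale r * r = P.ν r := by
  unfold dirScale
  rcases eq_or_ne r 0 with h | h
  · rw [h, P.ν_zero]; ring
  · field_simp
    ring

/-- `dirScale ≡ 1` on `(-∞, 1 - 3ε]`. [folklore] -/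
theorem dirScale_of_le {r : ℝ} (hr : r ≤ 1 - 3 * P.ε) : P.dirScale r = 1 := by
  unfold dirScale; rw [P.ν_of_le r hr]; ring

/-- `dirScale r = 1/r` on `[1 - ε, ∞)`. [folklore] -/
theorem dirScale_of_ge {r : ℝ} (hr : 1 - P.ε ≤ r) : P.dirScale r = r⁻¹ := by
  unfold dirScale; rw [P.ν_of_ge r hr]
  have : r ≠ 0 := by
    have : 0 < r := by linarith [P.ε_pos, P.ε_le]
    exact this.ne'
  field_simp
  ring

/-- `dirScale r = ν r / r` for `r ≠ 0`. [folklore] -/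
theorem dirScale_eq_div {r : ℝ} (hr : r ≠ 0) : P.dirScale r = P.ν r / r := by
  rw [← P.dirScale_mul r]; field_simp

/-- `dirScale r > 0` for `r ≥ 0`. [folklore] -/
theorem dirScale_pos {r : ℝ} (hr : 0 ≤ r) : 0 < P.dirScale r := by
  rcases hr.eq_or_lt with h | h
  · rw [← h, P.dirScale_of_le P.one_sub_three_mul_pos.le]; exact one_pos
  · rw [P.dirScale_eq_div h.ne']; exact div_pos (P.ν_pos h) h

/-- `dirScale` is smooth (it is `1` near `0` and `1 + (ν r - r)/r` elsewhere). [folklore] -/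
theorem contDiff_dirScale : ContDiff ℝ ∞ P.dirScale := by
  rw [contDiff_iff_contDiffAt]
  intro r
  rcases eq_or_ne r 0 with h | h
  · have hev : P.dirScale =ᶠ[𝓝 r] fun _ => (1 : ℝ) := by
      have hm : Iio (1 - 3 * P.ε) ∈ 𝓝 r := Iio_mem_nhds (by rw [h]; exact P.one_sub_three_mul_pos)
      exact eventuallyEq_of_mem hm fun s hs => P.dirScale_of_le (le_of_lt hs)
    exact contDiffAt_const.congr_of_eventuallyEq hev
  · show ContDiffAt ℝ ∞ (fun r => 1 + (P.ν r - r) * r⁻¹) r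
    exact contDiffAt_const.add ((P.contDiff_ν.contDiffAt.sub contDiffAt_id).mul
      (contDiffAt_inv ℝ h))

/-- `ν' = dirScale' · r + dirScale` (product rule on `ν r = dirScale r · r`). [folklore] -/
theorem hasDerivAt_ν_dirScale (r : ℝ) :
    HasDerivAt P.ν (deriv P.dirScale r * r + P.dirScale r) r := by
  have hd : HasDerivAt P.dirScale (deriv P.dirScale r) r :=
    ((P.contDiff_dirScale.differentiable (by simp)).differentiableAt).hasDerivAt
  have h := hd.mul (hasDerivAt_id' r)
  have hfun : (P.dirScale * fun y : ℝ => y) = P.ν := funext fun y => P.dirScale_mul y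
  rw [hfun] at h
  simpa using h

/-- `deriv ν r = deriv dirScale r · r + dirScale r`. [folklore] -/
theorem deriv_ν_eq (r : ℝ) : deriv P.ν r = deriv P.dirScale r * r + P.dirScale r :=
  (P.hasDerivAt_ν_dirScale r).deriv

section Dir

variable {V : Type*} [NormedAddCommGroup V] [InnerProductSpace ℝ V]

/-- **The direction map** `dir x = ν(‖x‖)/‖x‖ • x` (the identity on `‖x‖ ≤ 1 - 3ε`, the
radial retraction `x/‖x‖` onto the unit sphere on `1 - ε ≤ ‖x‖`). [folklore] -/
def dir (x : V) : V := P.dirScale ‖x‖ • x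

/-- `‖dir x‖ = ν ‖x‖`. [folklore] -/
theorem norm_dir (x : V) : ‖P.dir x‖ = P.ν ‖x‖ := by
  unfold dir
  rw [norm_smul, Real.norm_eq_abs, abs_of_pos (P.dirScale_pos (norm_nonneg x)), P.dirScale_mul]

/-- `dir x = x` for `‖x‖ ≤ 1 - 3ε`. [folklore] -/
theorem dir_of_norm_le {x : V} (hx : ‖x‖ ≤ 1 - 3 * P.ε) : P.dir x = x := by
  unfold dir; rw [P.dirScale_of_le hx, one_smul]

/-- `dir x = x/‖x‖` for `1 - ε ≤ ‖x‖`. [folklore] -/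
theorem dir_of_le_norm {x : V} (hx : 1 - P.ε ≤ ‖x‖) : P.dir x = ‖x‖⁻¹ • x := by
  unfold dir; rw [P.dirScale_of_ge hx]

/-- `dir x = x` on the unit sphere. [folklore] -/
theorem dir_of_norm_eq_one {x : V} (hx : ‖x‖ = 1) : P.dir x = x := by
  rw [P.dir_of_le_norm (by rw [hx]; linarith [P.ε_pos]), hx, inv_one, one_smul]

/-- `‖dir x‖ ≤ 1` everywhere. [folklore] -/
theorem norm_dir_le_one (x : V) : ‖P.dir x‖ ≤ 1 := by
  rw [P.norm_dir]; exact P.ν_le_one (norm_nonneg x)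

/-- `‖x‖ ≤ ‖dir x‖` on the closed unit ball. [folklore] -/
theorem norm_le_norm_dir {x : V} (hx : ‖x‖ ≤ 1) : ‖x‖ ≤ ‖P.dir x‖ := by
  rw [P.norm_dir]; exact P.le_ν _ (norm_nonneg x) hx

/-- `dir` is smooth. [folklore] -/
theorem contDiff_dir : ContDiff ℝ ∞ (P.dir : V → V) := by
  rw [contDiff_iff_contDiffAt]
  intro x
  rcases eq_or_ne x 0 with h | h
  · have hev : P.dir =ᶠ[𝓝 x] id := by
      have hm : ball (0 : V) (1 - 3 * P.ε) ∈ 𝓝 x := by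
        rw [h]; exact ball_mem_nhds _ P.one_sub_three_mul_pos
      exact eventuallyEq_of_mem hm fun y hy => P.dir_of_norm_le (le_of_lt (by simpa using hy))
    exact contDiffAt_id.congr_of_eventuallyEq hev
  · show ContDiffAt ℝ ∞ (fun y : V => P.dirScale ‖y‖ • y) x
    exact (P.contDiff_dirScale.contDiffAt.comp x (contDiffAt_norm ℝ h)).smul contDiffAt_id

/-- `dir` is continuous. [folklore] -/
theorem continuous_dir : Continuous (P.dir : V → V) := P.contDiff_dir.continuous

/-- **Chain rule through the norm, away from the origin**: if `g : ℝ → ℝ` has derivative `g'`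
at `‖x‖`, `x ≠ 0`, then `y ↦ g ‖y‖` has differential `g' · ⟨x, ·⟩/‖x‖` at `x`
(`D‖·‖(x) = ⟨x, ·⟩/‖x‖`, from `‖y‖ = √(‖y‖²)`). [folklore] -/
theorem hasFDerivAt_comp_norm {g : ℝ → ℝ} {g' : ℝ} {x : V} (hx : x ≠ 0)
    (hg : HasDerivAt g g' ‖x‖) :
    HasFDerivAt (fun y : V => g ‖y‖) (g' • (‖x‖⁻¹ • innerSL ℝ x)) x := by
  have hpos : 0 < ‖x‖ := norm_pos_iff.2 hx
  have h1 : HasFDerivAt (fun y : V => ‖y‖ ^ 2) (2 • innerSL ℝ x) x :=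
    (hasStrictFDerivAt_norm_sq x).hasFDerivAt
  have hx2 : ‖x‖ ^ 2 ≠ 0 := by positivity
  have h3 : HasFDerivAt (fun y : V => Real.sqrt (‖y‖ ^ 2))
      ((1 / (2 * Real.sqrt (‖x‖ ^ 2))) • (2 • innerSL ℝ x)) x :=
    (Real.hasDerivAt_sqrt hx2).comp_hasFDerivAt x h1
  simp only [Real.sqrt_sq_eq_abs, abs_norm] at h3
  have h4 : HasFDerivAt (fun y : V => ‖y‖) (‖x‖⁻¹ • innerSL ℝ x) x := by
    refine h3.congr_fderiv ?_
    ext u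
    simp only [FunLike.coe_smul, Pi.smul_apply, smul_eq_mul, nsmul_eq_mul, Nat.cast_ofNat,
      Pi.mul_apply, Pi.ofNat_apply]
    field_simp
  exact hg.comp_hasFDerivAt x h4

/-- The differential of `dir` at `x ≠ 0`, as a continuous linear map:
`v ↦ dirScale ‖x‖ • v + (dirScale' ‖x‖ · ⟨x, v⟩/‖x‖) • x`. [folklore] -/
def dirDeriv (x : V) : V →L[ℝ] V :=
  P.dirScale ‖x‖ • ContinuousLinearMap.id ℝ V +
    ((deriv P.dirScale ‖x‖) • (‖x‖⁻¹ • innerSL ℝ x)).smulRight x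

/-- Evaluation of `dirDeriv`. [folklore] -/
theorem dirDeriv_apply (x v : V) :
    P.dirDeriv x v = P.dirScale ‖x‖ • v + (deriv P.dirScale ‖x‖ * (‖x‖⁻¹ * ⟪x, v⟫)) • x := by
  simp [dirDeriv, ContinuousLinearMap.smulRight_apply]

/-- `D dir (x) = dirDeriv x` for `x ≠ 0`. [folklore] -/
theorem hasFDerivAt_dir {x : V} (hx : x ≠ 0) : HasFDerivAt (P.dir : V → V) (P.dirDeriv x) x := by
  have hd : HasDerivAt P.dirScale (deriv P.dirScale ‖x‖) ‖x‖ :=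
    ((P.contDiff_dirScale.differentiable (by simp)).differentiableAt).hasDerivAt
  have h1 : HasFDerivAt (fun y : V => P.dirScale ‖y‖)
      ((deriv P.dirScale ‖x‖) • (‖x‖⁻¹ • innerSL ℝ x)) x := hasFDerivAt_comp_norm hx hd
  exact h1.smul (hasFDerivAt_id x)

/-- `D dir (x) = id` for `‖x‖ < 1 - 3ε`. [folklore] -/
theorem hasFDerivAt_dir_of_norm_lt {x : V} (hx : ‖x‖ < 1 - 3 * P.ε) :
    HasFDerivAt (P.dir : V → V) (ContinuousLinearMap.id ℝ V) x := by
  refine (hasFDerivAt_id x).congr_of_eventuallyEq ?_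
  have hm : {y : V | ‖y‖ < 1 - 3 * P.ε} ∈ 𝓝 x :=
    (isOpen_lt continuous_norm continuous_const).mem_nhds hx
  exact eventuallyEq_of_mem hm fun y hy => P.dir_of_norm_le (le_of_lt hy)

/-- **Where `ν' > 0` the differential of `dir` is injective**: for `x ≠ 0` with `‖x‖ < 1 - ε`,
`dirDeriv x v = 0` forces `v = 0` (pair with `x`: `⟨x, v⟩ · ν'(‖x‖) = 0`, then the tangential
part). [folklore] -/
theorem eq_zero_of_dirDeriv_eq_zero {x v : V} (hx : x ≠ 0) (hx1 : ‖x‖ < 1 - P.ε)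
    (hv : P.dirDeriv x v = 0) : v = 0 := by
  set r := ‖x‖ with hr_def
  have hr : 0 < r := norm_pos_iff.2 hx
  rw [P.dirDeriv_apply] at hv
  have h1 : ⟪x, P.dirScale r • v + (deriv P.dirScale r * (r⁻¹ * ⟪x, v⟫)) • x⟫ = 0 := by
    rw [hv, inner_zero_right]
  rw [inner_add_right, inner_smul_right, inner_smul_right, real_inner_self_eq_norm_sq,
    ← hr_def] at h1
  have h2 : ⟪x, v⟫ * deriv P.ν r = 0 := by
    rw [P.deriv_ν_eq]
    have : ⟪x, v⟫ * (deriv P.dirScale r * r + P.dirScale r) =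
        P.dirScale r * ⟪x, v⟫ + deriv P.dirScale r * (r⁻¹ * ⟪x, v⟫) * r ^ 2 := by
      field_simp
      ring
    rw [this]
    exact h1
  have hxv : ⟪x, v⟫ = 0 := (mul_eq_zero.1 h2).resolve_right (P.ν_deriv_pos r hx1).ne'
  rw [hxv, mul_zero, mul_zero, zero_smul, add_zero] at hv
  exact (smul_eq_zero.1 hv).resolve_left (P.dirScale_pos hr.le).ne'

/-- For a vector orthogonal to `x`, `dirDeriv x v = dirScale ‖x‖ • v`; so such a `v` in the
kernel vanishes. [folklore] -/
theorem eq_zero_of_dirDeriv_eq_zero_of_inner {x v : V} (hxv : ⟪x, v⟫ = 0)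
    (hv : P.dirDeriv x v = 0) : v = 0 := by
  rw [P.dirDeriv_apply, hxv, mul_zero, mul_zero, zero_smul, add_zero] at hv
  exact (smul_eq_zero.1 hv).resolve_left (P.dirScale_pos (norm_nonneg x)).ne'

end Dir

/-! ### §3 The pushed disc -/

section Push

variable {V : Type*} [NormedAddCommGroup V] [InnerProductSpace ℝ V]
  {F : Type*} [NormedAddCommGroup F] [InnerProductSpace ℝ F]

/-- **The pushed disc map** `push P E x = μ(‖x‖) • E (dir x)`: the region `E(𝔻)` of the unit
sphere of `F` pushed into the ball to height `μ`, rim kept fixed and radial. [folklore] -/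
def push (E : V → F) (x : V) : F := P.μ ‖x‖ • E (P.dir x)

variable (E : V → F)

/-- Unfolding lemma. [folklore] -/
theorem push_apply (x : V) : P.push E x = P.μ ‖x‖ • E (P.dir x) := rfl

/-- **Height**: `‖push x‖ = μ ‖x‖` when `E` takes values on the unit sphere. [folklore] -/
theorem norm_push (hE1 : ∀ y, ‖E y‖ = 1) (x : V) : ‖P.push E x‖ = P.μ ‖x‖ := by
  rw [push, norm_smul, Real.norm_eq_abs, abs_of_pos (P.μ_pos _), hE1, mul_one]

/-- **Radial rim**: `push x = ‖x‖ • E(x/‖x‖)` for `1 - ε ≤ ‖x‖`. [folklore] -/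
theorem push_of_le_norm {x : V} (hx : 1 - P.ε ≤ ‖x‖) : P.push E x = ‖x‖ • E (‖x‖⁻¹ • x) := by
  rw [push, P.μ_of_ge _ hx, P.dir_of_le_norm hx]

/-- `push = E` on the unit sphere. [folklore] -/
theorem push_of_norm_eq_one {x : V} (hx : ‖x‖ = 1) : P.push E x = E x := by
  rw [push, hx, P.μ_one, one_smul, P.dir_of_norm_eq_one hx]

/-- **Floor**: `push x = (1 - 2ε) • E x` for `‖x‖ ≤ 1 - 3ε`. [folklore] -/
theorem push_of_norm_le {x : V} (hx : ‖x‖ ≤ 1 - 3 * P.ε) :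
    P.push E x = (1 - 2 * P.ε) • E x := by
  rw [push, P.μ_of_le _ (by linarith [P.ε_pos]), P.dir_of_norm_le hx]

/-- `‖push x‖ = ‖x‖` for `1 - ε ≤ ‖x‖`. [folklore] -/
theorem norm_push_of_le_norm (hE1 : ∀ y, ‖E y‖ = 1) {x : V} (hx : 1 - P.ε ≤ ‖x‖) :
    ‖P.push E x‖ = ‖x‖ := by
  rw [P.norm_push E hE1, P.μ_of_ge _ hx]

/-- `1 - 2ε ≤ ‖push x‖`: the disc hangs at height at least `1 - 2ε`. [folklore] -/
theorem le_norm_push (hE1 : ∀ y, ‖E y‖ = 1) (x : V) : 1 - 2 * P.ε ≤ ‖P.push E x‖ := by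
  rw [P.norm_push E hE1]; exact P.le_μ _

/-- `‖push x‖ < 1` for `‖x‖ < 1`. [folklore] -/
theorem norm_push_lt_one (hE1 : ∀ y, ‖E y‖ = 1) {x : V} (hx : ‖x‖ < 1) : ‖P.push E x‖ < 1 := by
  rw [P.norm_push E hE1]; exact P.μ_lt_one hx

/-- `‖push x‖ ≤ 1` for `‖x‖ ≤ 1`. [folklore] -/
theorem norm_push_le_one (hE1 : ∀ y, ‖E y‖ = 1) {x : V} (hx : ‖x‖ ≤ 1) : ‖P.push E x‖ ≤ 1 := by
  rw [P.norm_push E hE1]; exact P.μ_le_one hx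

/-- `‖push x‖ = 1 ↔ ‖x‖ = 1`: the pushed disc meets the unit sphere exactly in its rim (NEAT).
[folklore] -/
theorem norm_push_eq_one_iff (hE1 : ∀ y, ‖E y‖ = 1) (x : V) : ‖P.push E x‖ = 1 ↔ ‖x‖ = 1 := by
  rw [P.norm_push E hE1]; exact P.μ_eq_one_iff _

/-- `push` maps the open unit ball into the open unit ball. [folklore] -/
theorem mapsTo_push_ball (hE1 : ∀ y, ‖E y‖ = 1) : MapsTo (P.push E) (ball 0 1) (ball 0 1) :=
  fun _ hx => mem_ball_zero_iff.2 (P.norm_push_lt_one E hE1 (mem_ball_zero_iff.1 hx))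

/-- `push` maps the closed unit ball into the closed unit ball. [folklore] -/
theorem mapsTo_push_closedBall (hE1 : ∀ y, ‖E y‖ = 1) :
    MapsTo (P.push E) (closedBall 0 1) (closedBall 0 1) :=
  fun _ hx => mem_closedBall_zero_iff.2 (P.norm_push_le_one E hE1 (mem_closedBall_zero_iff.1 hx))

/-- The rim: `push(∂𝔻) = E(∂𝔻)`. [folklore] -/
theorem image_push_sphere : P.push E '' sphere 0 1 = E '' sphere 0 1 := by
  ext z
  simp only [mem_image, mem_sphere_zero_iff_norm]
  constructor
  · rintro ⟨x, hx, rfl⟩; exact ⟨x, hx, (P.push_of_norm_eq_one E hx).symm⟩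
  · rintro ⟨x, hx, rfl⟩; exact ⟨x, hx, P.push_of_norm_eq_one E hx⟩

/-- Only the rim lies on the unit sphere. [folklore] -/
theorem preimage_push_sphere (hE1 : ∀ y, ‖E y‖ = 1) : P.push E ⁻¹' sphere 0 1 = sphere 0 1 := by
  ext x
  simp only [mem_preimage, mem_sphere_zero_iff_norm, P.norm_push_eq_one_iff E hE1]

/-- `push` is smooth (for smooth `E`). [folklore] -/
theorem contDiff_push (hE : ContDiff ℝ ∞ E) : ContDiff ℝ ∞ (P.push E) := by
  have hμn : ContDiff ℝ ∞ (fun x : V => P.μ ‖x‖) := by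
    rw [contDiff_iff_contDiffAt]
    intro x
    rcases eq_or_ne x 0 with h | h
    · have hev : (fun x : V => P.μ ‖x‖) =ᶠ[𝓝 x] fun _ => 1 - 2 * P.ε := by
        have hm : ball (0 : V) (1 - 2 * P.ε) ∈ 𝓝 x := by
          rw [h]; exact ball_mem_nhds _ (by linarith [P.ε_pos, P.ε_le])
        exact eventuallyEq_of_mem hm fun y hy => P.μ_of_le _ (le_of_lt (by simpa using hy))
      exact contDiffAt_const.congr_of_eventuallyEq hev
    · exact P.contDiff_μ.contDiffAt.comp x (contDiffAt_norm ℝ h)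
  exact hμn.smul (hE.comp P.contDiff_dir)

/-- `push` is continuous (for continuous `E`). [folklore] -/
theorem continuous_push (hE : Continuous E) : Continuous (P.push E) :=
  (P.contDiff_μ.continuous.comp continuous_norm).smul (hE.comp P.continuous_dir)

/-- **`push` is injective** (for `E` injective with values on the unit sphere): heights give
`μ ‖x‖ = μ ‖y‖`, directions give `dir x = dir y` hence `ν ‖x‖ = ν ‖y‖`, so `‖x‖ = ‖y‖`
(`eq_of_μ_eq_of_ν_eq`) and then `x = y`. [folklore] -/
theorem injective_push (hE1 : ∀ y, ‖E y‖ = 1) (hEi : Injective E) : Injective (P.push E) := by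
  intro x y hxy
  have hn : P.μ ‖x‖ = P.μ ‖y‖ := by
    have := congrArg norm hxy
    rwa [P.norm_push E hE1, P.norm_push E hE1] at this
  have hE' : E (P.dir x) = E (P.dir y) := by
    have h := hxy
    rw [push_apply, push_apply, hn] at h
    exact smul_right_injective F (P.μ_pos _).ne' h
  have hd : P.dir x = P.dir y := hEi hE'
  have hν : P.ν ‖x‖ = P.ν ‖y‖ := by rw [← P.norm_dir, ← P.norm_dir, hd]
  have hr : ‖x‖ = ‖y‖ := P.eq_of_μ_eq_of_ν_eq (norm_nonneg _) (norm_nonneg _) hn hν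
  unfold dir at hd
  rw [hr] at hd
  exact smul_right_injective V (P.dirScale_pos (norm_nonneg y)).ne' hd

/-- A map with values on the unit sphere is orthogonal to its differential:
`⟨E y, DE(y) w⟩ = 0` (differentiate `‖E‖² ≡ 1`). [folklore] -/
theorem inner_fderiv_eq_zero (hE : Differentiable ℝ E) (hE1 : ∀ y, ‖E y‖ = 1) (y w : V) :
    ⟪E y, fderiv ℝ E y w⟫ = 0 := by
  have h1 : HasFDerivAt (fun y => ‖E y‖ ^ 2) (2 • (innerSL ℝ (E y)).comp (fderiv ℝ E y)) y :=
    (hE y).hasFDerivAt.norm_sq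
  have h2 : HasFDerivAt (fun y : V => ‖E y‖ ^ 2) (0 : V →L[ℝ] ℝ) y := by
    have : (fun y : V => ‖E y‖ ^ 2) = fun _ => 1 := funext fun y => by rw [hE1, one_pow]
    rw [this]; exact hasFDerivAt_const 1 y
  have h3 := congrArg (fun L : V →L[ℝ] ℝ => L w) (h1.unique h2)
  have h4 : (2 : ℝ) * ⟪E y, fderiv ℝ E y w⟫ = 0 := by simpa using h3
  exact (mul_eq_zero.1 h4).resolve_left two_ne_zero

/-- The differential of `push` at `x ≠ 0`. [folklore] -/
theorem hasFDerivAt_push (hE : ContDiff ℝ ∞ E) {x : V} (hx : x ≠ 0) :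
    HasFDerivAt (P.push E)
      (P.μ ‖x‖ • ((fderiv ℝ E (P.dir x)).comp (P.dirDeriv x)) +
        ((deriv P.μ ‖x‖) • (‖x‖⁻¹ • innerSL ℝ x)).smulRight (E (P.dir x))) x := by
  have hμ : HasDerivAt P.μ (deriv P.μ ‖x‖) ‖x‖ :=
    ((P.contDiff_μ.differentiable (by simp)).differentiableAt).hasDerivAt
  have h1 : HasFDerivAt (fun y : V => P.μ ‖y‖) ((deriv P.μ ‖x‖) • (‖x‖⁻¹ • innerSL ℝ x)) x :=
    hasFDerivAt_comp_norm hx hμ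
  have hEd : HasFDerivAt E (fderiv ℝ E (P.dir x)) (P.dir x) :=
    ((hE.differentiable (by simp)) _).hasFDerivAt
  have h2 : HasFDerivAt (fun y => E (P.dir y)) ((fderiv ℝ E (P.dir x)).comp (P.dirDeriv x)) x :=
    hEd.comp x (P.hasFDerivAt_dir hx)
  exact h1.smul h2

/-- The differential of `push` on the floor `‖x‖ < 1 - 3ε` is `(1 - 2ε) • DE(x)`. [folklore] -/
theorem hasFDerivAt_push_of_norm_lt (hE : ContDiff ℝ ∞ E) {x : V} (hx : ‖x‖ < 1 - 3 * P.ε) :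
    HasFDerivAt (P.push E) ((1 - 2 * P.ε) • fderiv ℝ E x) x := by
  have hEd : HasFDerivAt E (fderiv ℝ E x) x := ((hE.differentiable (by simp)) _).hasFDerivAt
  refine (hEd.const_smul (1 - 2 * P.ε)).congr_of_eventuallyEq ?_
  have hm : {y : V | ‖y‖ < 1 - 3 * P.ε} ∈ 𝓝 x :=
    (isOpen_lt continuous_norm continuous_const).mem_nhds hx
  exact eventuallyEq_of_mem hm fun y hy => P.push_of_norm_le E (le_of_lt hy)

/-- **`push` is an immersion**: its differential is injective everywhere (for smooth `E` with
values on the unit sphere and injective differential).  On the floor this is `(1 - 2ε) DE`;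
elsewhere a kernel vector `v` has `DE(dir x)(D dir(x) v) ⊥ E(dir x)`-component and radial
component vanishing separately, so `D dir(x) v = 0` and `μ'(‖x‖)⟨x, v⟩ = 0`; for
`‖x‖ < 1 - ε` the first forces `v = 0` (`ν' > 0`), for `‖x‖ ≥ 1 - ε` the second gives
`⟨x, v⟩ = 0` (`μ' > 0`) and then the first does. [folklore] -/
theorem injective_fderiv_push (hE : ContDiff ℝ ∞ E) (hE1 : ∀ y, ‖E y‖ = 1)
    (hEd : ∀ y, Injective (fderiv ℝ E y)) (x : V) : Injective (fderiv ℝ (P.push E) x) := by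
  have hdiff : Differentiable ℝ E := hE.differentiable (by simp)
  rcases lt_or_ge ‖x‖ (1 - 3 * P.ε) with hx3 | hx3
  · rw [(P.hasFDerivAt_push_of_norm_lt E hE hx3).fderiv]
    intro v w hvw
    have h : (1 - 2 * P.ε) • fderiv ℝ E x v = (1 - 2 * P.ε) • fderiv ℝ E x w := by
      simpa using hvw
    have hne : (1 - 2 * P.ε) ≠ 0 := by
      have : 0 < 1 - 2 * P.ε := by linarith [P.ε_pos, P.ε_le]
      exact this.ne'
    exact hEd x (smul_right_injective F hne h)
  · have hx : x ≠ 0 := by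
      intro h
      rw [h, norm_zero] at hx3
      linarith [P.one_sub_three_mul_pos]
    have hr : 0 < ‖x‖ := norm_pos_iff.2 hx
    rw [(P.hasFDerivAt_push E hE hx).fderiv]
    refine (injective_iff_map_eq_zero _).2 fun v hv => ?_
    have hv' : P.μ ‖x‖ • fderiv ℝ E (P.dir x) (P.dirDeriv x v) +
        (deriv P.μ ‖x‖ * (‖x‖⁻¹ * ⟪x, v⟫)) • E (P.dir x) = 0 := by
      simpa [ContinuousLinearMap.smulRight_apply, mul_assoc] using hv
    have h1 : ⟪E (P.dir x), P.μ ‖x‖ • fderiv ℝ E (P.dir x) (P.dirDeriv x v) +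
        (deriv P.μ ‖x‖ * (‖x‖⁻¹ * ⟪x, v⟫)) • E (P.dir x)⟫ = 0 := by
      rw [hv', inner_zero_right]
    rw [inner_add_right, inner_smul_right, inner_smul_right,
      inner_fderiv_eq_zero E hdiff hE1, mul_zero, zero_add, real_inner_self_eq_norm_sq, hE1,
      one_pow, mul_one] at h1
    rw [h1, zero_smul, add_zero] at hv'
    have hw : P.dirDeriv x v = 0 := by
      have h := (smul_eq_zero.1 hv').resolve_left (P.μ_pos _).ne'
      exact (injective_iff_map_eq_zero _).1 (hEd (P.dir x)) _ h
    rcases lt_or_ge ‖x‖ (1 - P.ε) with hx1 | hx1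
    · exact P.eq_zero_of_dirDeriv_eq_zero hx hx1 hw
    · have hμ' : 0 < deriv P.μ ‖x‖ := P.μ_deriv_pos _ (by linarith [P.ε_pos])
      have hxv : ⟪x, v⟫ = 0 := by
        rcases mul_eq_zero.1 h1 with h | h
        · exact absurd h hμ'.ne'
        · rcases mul_eq_zero.1 h with h | h
          · exact absurd h (inv_ne_zero hr.ne')
          · exact h
      exact P.eq_zero_of_dirDeriv_eq_zero_of_inner hxv hw

/-! ### §4 The pushed disc is a smooth (closed) embedding -/

/-- Preimages of compact sets under `push` are compact (`‖push x‖ = ‖x‖` for `‖x‖ ≥ 1`), so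
`push` is proper. [folklore] -/
theorem isCompact_preimage_push [FiniteDimensional ℝ V] (hE : Continuous E)
    (hE1 : ∀ y, ‖E y‖ = 1) {K : Set F} (hK : IsCompact K) : IsCompact (P.push E ⁻¹' K) := by
  obtain ⟨R, hR⟩ := hK.isBounded.subset_closedBall 0
  apply Metric.isCompact_of_isClosed_isBounded (hK.isClosed.preimage (P.continuous_push E hE))
  refine (isBounded_iff_subset_closedBall 0).2 ⟨max R 1, fun x hx => ?_⟩
  rw [mem_closedBall_zero_iff]
  rcases le_or_gt ‖x‖ 1 with h | h
  · exact h.trans (le_max_right _ _)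
  · have hn : ‖P.push E x‖ = ‖x‖ := P.norm_push_of_le_norm E hE1 (by linarith [P.ε_pos])
    have hxK : P.push E x ∈ closedBall (0 : F) R := hR hx
    rw [mem_closedBall_zero_iff, hn] at hxK
    exact hxK.trans (le_max_left _ _)

/-- `push` is a closed topological embedding. [folklore] -/
theorem isClosedEmbedding_push [FiniteDimensional ℝ V] (hE : Continuous E)
    (hE1 : ∀ y, ‖E y‖ = 1) (hEi : Injective E) : Topology.IsClosedEmbedding (P.push E) :=
  .of_continuous_injective_isClosedMap (P.continuous_push E hE) (P.injective_push E hE1 hEi)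
    ((isProperMap_iff_isCompact_preimage.2
      ⟨P.continuous_push E hE, fun _ hK => P.isCompact_preimage_push E hE hE1 hK⟩).isClosedMap)

/-- **The pushed disc is a smooth embedding** `V ↪ F` (closed, proper): a smooth injective
immersion which is proper.  For `E : V → F` smooth with values on the unit sphere, injective,
with injective differential. [folklore] -/
theorem isSmoothEmbedding_push [FiniteDimensional ℝ V] [FiniteDimensional ℝ F]
    (hE : ContDiff ℝ ∞ E) (hE1 : ∀ y, ‖E y‖ = 1) (hEi : Injective E)
    (hEd : ∀ y, Injective (fderiv ℝ E y)) :
    Manifold.IsSmoothEmbedding 𝓘(ℝ, V) 𝓘(ℝ, F) ∞ (P.push E) := by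
  refine ⟨isImmersion_of_injective_mfderiv (P.contDiff_push E hE).contMDiff
    (by exact_mod_cast le_top) fun x => ?_,
    (P.isClosedEmbedding_push E hE.continuous hE1 hEi).isEmbedding⟩
  rw [mfderiv_eq_fderiv]
  exact P.injective_fderiv_push E hE hE1 hEd x

end Push

/-! ### §5 Discs from embeddings into the round sphere -/

section Sphere

variable {V : Type*} [NormedAddCommGroup V] [InnerProductSpace ℝ V]
  {F : Type*} [NormedAddCommGroup F] [InnerProductSpace ℝ F] {m : ℕ}
  [Fact (Module.finrank ℝ F = m + 1)]

/-- The hypotheses of §3–§4 for `E = (↑) ∘ e`, `e : V → 𝕊ᵐ ⊆ F` a smooth embedding into the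
round sphere: `E` is smooth, unit-valued, injective, with injective differential (the
inclusion of the sphere is an immersion, `mfderiv_coe_sphere_injective`, and so is `e`,
`injective_mfderiv_of_isImmersionAt'`). [folklore] -/
theorem sphere_comp_hyps (e : V → sphere (0 : F) 1)
    (he : Manifold.IsSmoothEmbedding 𝓘(ℝ, V) (𝓡 m) ∞ e) :
    ContDiff ℝ ∞ (Subtype.val ∘ e : V → F) ∧ (∀ y, ‖(Subtype.val ∘ e) y‖ = 1) ∧
      Injective (Subtype.val ∘ e) ∧ ∀ y, Injective (fderiv ℝ (Subtype.val ∘ e : V → F) y) := by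
  have hc : ContMDiff 𝓘(ℝ, V) 𝓘(ℝ, F) ∞ (Subtype.val ∘ e : V → F) :=
    contMDiff_coe_sphere.comp he.contMDiff
  refine ⟨contMDiff_iff_contDiff.1 hc, fun y => by simp, ?_, fun y => ?_⟩
  · exact Subtype.val_injective.comp he.isEmbedding.injective
  · rw [← mfderiv_eq_fderiv]
    have h1 : MDifferentiableAt (𝓡 m) 𝓘(ℝ, F) (Subtype.val : sphere (0 : F) 1 → F) (e y) :=
      (contMDiff_coe_sphere (m := ∞) (e y)).mdifferentiableAt (by simp)
    have h2 : MDifferentiableAt 𝓘(ℝ, V) (𝓡 m) e y := (he.contMDiff y).mdifferentiableAt (by simp)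
    rw [mfderiv_comp y h1 h2]
    exact (mfderiv_coe_sphere_injective (e y)).comp
      (injective_mfderiv_of_isImmersionAt' (he.isImmersion.isImmersionAt y))

/-- **The pushed disc of an embedded region of the round sphere is a smooth embedding.**
[folklore] -/
theorem isSmoothEmbedding_push_sphere [FiniteDimensional ℝ V] (e : V → sphere (0 : F) 1)
    (he : Manifold.IsSmoothEmbedding 𝓘(ℝ, V) (𝓡 m) ∞ e) :
    Manifold.IsSmoothEmbedding 𝓘(ℝ, V) 𝓘(ℝ, F) ∞ (P.push (Subtype.val ∘ e : V → F)) := by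
  haveI : FiniteDimensional ℝ F := .of_fact_finrank_eq_succ m
  obtain ⟨h1, h2, h3, h4⟩ := sphere_comp_hyps e he
  exact P.isSmoothEmbedding_push _ h1 h2 h3 h4

/-- **Neat pushed discs with radial rims (packaged).**  For a smooth embedding `e : V → 𝕊ᵐ` of a
Euclidean space into the round sphere of `F` and `ε ∈ (0, 1/4]` there is a smooth embedding
`Φ : V ↪ F` (namely `push (std ε) ((↑) ∘ e)`) with: `Φ = e` on the unit sphere of `V`,
`Φ x = ‖x‖ • e(x/‖x‖)` on the rim collar `1 - ε ≤ ‖x‖` (so `‖Φ x‖ = ‖x‖` there),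
`Φ x = (1 - 2ε) • e x` on the floor `‖x‖ ≤ 1 - 3ε`, heights `1 - 2ε ≤ ‖Φ x‖`, `‖Φ x‖ < 1` for
`‖x‖ < 1`, `‖Φ x‖ = 1 ↔ ‖x‖ = 1` (neatness), and `Φ(∂𝔻) = e(∂𝔻)`. [folklore] -/
theorem exists_pushedDisc [FiniteDimensional ℝ V] (e : V → sphere (0 : F) 1)
    (he : Manifold.IsSmoothEmbedding 𝓘(ℝ, V) (𝓡 m) ∞ e) {ε : ℝ} (hε : 0 < ε) (hε4 : 4 * ε ≤ 1) :
    ∃ Φ : V → F, Manifold.IsSmoothEmbedding 𝓘(ℝ, V) 𝓘(ℝ, F) ∞ Φ ∧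
      (∀ x, ‖x‖ = 1 → Φ x = e x) ∧
      (∀ x, 1 - ε ≤ ‖x‖ → Φ x = ‖x‖ • (e (‖x‖⁻¹ • x) : F)) ∧
      (∀ x, ‖x‖ ≤ 1 - 3 * ε → Φ x = (1 - 2 * ε) • (e x : F)) ∧
      (∀ x, 1 - 2 * ε ≤ ‖Φ x‖) ∧ (∀ x, ‖x‖ < 1 → ‖Φ x‖ < 1) ∧ (∀ x, ‖Φ x‖ = 1 ↔ ‖x‖ = 1) ∧
      (∀ x, 1 - ε ≤ ‖x‖ → ‖Φ x‖ = ‖x‖) ∧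
      Φ '' sphere 0 1 = (Subtype.val ∘ e) '' sphere 0 1 := by
  set P := std ε hε hε4 with hP
  have h2 : ∀ y, ‖(Subtype.val ∘ e) y‖ = 1 := fun y => by simp
  refine ⟨P.push (Subtype.val ∘ e), P.isSmoothEmbedding_push_sphere e he,
    fun x hx => P.push_of_norm_eq_one _ hx, fun x hx => P.push_of_le_norm _ hx,
    fun x hx => P.push_of_norm_le _ hx, fun x => P.le_norm_push _ h2 x,
    fun x hx => P.norm_push_lt_one _ h2 hx, fun x => P.norm_push_eq_one_iff _ h2 x,
    fun x hx => P.norm_push_of_le_norm _ h2 hx, P.image_push_sphere _⟩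

end Sphere

/-! ### §6 Laminar families: disjointness of pushed discs -/

section Laminar

variable {V : Type*} [NormedAddCommGroup V] [InnerProductSpace ℝ V]
  {F : Type*} [NormedAddCommGroup F] [InnerProductSpace ℝ F]

/-- **Discs under disjoint regions are disjoint.** [folklore] -/
theorem disjoint_image_push_of_disjoint (P₁ P₂ : PushProfile) {E₁ E₂ : V → F}
    (h1 : ∀ y, ‖E₁ y‖ = 1) (h2 : ∀ y, ‖E₂ y‖ = 1)
    (h : Disjoint (E₁ '' closedBall 0 1) (E₂ '' closedBall 0 1)) :
    Disjoint (P₁.push E₁ '' closedBall 0 1) (P₂.push E₂ '' closedBall 0 1) := by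
  rw [Set.disjoint_left]
  rintro z ⟨x₁, -, rfl⟩ ⟨x₂, -, h12⟩
  have hn : P₂.μ ‖x₂‖ = P₁.μ ‖x₁‖ := by
    have := congrArg norm h12
    rwa [P₂.norm_push E₂ h2, P₁.norm_push E₁ h1] at this
  have hdir : E₂ (P₂.dir x₂) = E₁ (P₁.dir x₁) := by
    rw [push_apply, push_apply, hn] at h12
    exact smul_right_injective F (P₁.μ_pos _).ne' h12
  exact Set.disjoint_left.1 h ⟨P₁.dir x₁, mem_closedBall_zero_iff.2 (P₁.norm_dir_le_one x₁), rfl⟩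
    ⟨P₂.dir x₂, mem_closedBall_zero_iff.2 (P₂.norm_dir_le_one x₂), hdir⟩

/-- **Nested regions: the inner disc hangs strictly above the outer one.**  If the region of
`E₂` lies in the floor part `E₁(𝔻_{1-3ε₁})` of the region of `E₁` (injective) and the inner
profile is finer (`ε₂ < ε₁`), the two pushed discs are disjoint: over the inner region the outer
disc is at height exactly `1 - 2ε₁`, the inner one at height `≥ 1 - 2ε₂`. [folklore] -/
theorem disjoint_image_push_of_subset (P₁ P₂ : PushProfile) {E₁ E₂ : V → F}
    (h1 : ∀ y, ‖E₁ y‖ = 1) (h2 : ∀ y, ‖E₂ y‖ = 1) (hE₁ : Injective E₁)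
    (hsub : E₂ '' closedBall 0 1 ⊆ E₁ '' closedBall 0 (1 - 3 * P₁.ε)) (hε : P₂.ε < P₁.ε) :
    Disjoint (P₁.push E₁ '' closedBall 0 1) (P₂.push E₂ '' closedBall 0 1) := by
  rw [Set.disjoint_left]
  rintro z ⟨x₁, hx₁, rfl⟩ ⟨x₂, -, h12⟩
  have hn : P₂.μ ‖x₂‖ = P₁.μ ‖x₁‖ := by
    have := congrArg norm h12
    rwa [P₂.norm_push E₂ h2, P₁.norm_push E₁ h1] at this
  have hdir : E₂ (P₂.dir x₂) = E₁ (P₁.dir x₁) := by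
    rw [push_apply, push_apply, hn] at h12
    exact smul_right_injective F (P₁.μ_pos _).ne' h12
  obtain ⟨y, hy, hyE⟩ :=
    hsub ⟨P₂.dir x₂, mem_closedBall_zero_iff.2 (P₂.norm_dir_le_one x₂), hdir⟩
  have hyd : y = P₁.dir x₁ := hE₁ hyE
  have hx₁n : ‖x₁‖ ≤ 1 - 3 * P₁.ε := by
    have h := P₁.norm_le_norm_dir (mem_closedBall_zero_iff.1 hx₁)
    rw [← hyd] at h
    exact h.trans (mem_closedBall_zero_iff.1 hy)
  have hμ₁ : P₁.μ ‖x₁‖ = 1 - 2 * P₁.ε := P₁.μ_of_le _ (by linarith [P₁.ε_pos])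
  have hμ₂ : 1 - 2 * P₂.ε ≤ P₂.μ ‖x₂‖ := P₂.le_μ _
  linarith

end Laminar

end PushProfile

end Literature.Topology.FourManifolds
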